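import Literature.Computability.Cryptography.VanDamSeroussiCubicSignal
import Literature.Computability.Cryptography.VanDamSeroussiCubicFourier
import HarnessLib

/-!
# The quantum block of the cubic Gauss-sum experiment, VIII: combining the nine statistics

Topic `Literature/Computability/Cryptography`; sequel of `VanDamSeroussiCubicSignal.lean`. The coset
flag of the block (`flagVal`, computed reversibly from `s^{(p−1)/3} mod p`) selects exactly the
class `χ(s) = ω^{c'}` of the cubic residue character (`mem_goodS_iff_chiN`), so the transform `R` of
the component `c'` is the transform of the class indicator; the statistics of the components for
the properties "`χ(k_f) = ω^c`" of the decoded frequency combine, with the weights `ω^{c+c'}`, into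
`Σ_f conj(S f) χ(k_f) (Sχ̂)(f) ≈ G · goodWeight` (`sum_omega_pow_coset_eq`, `cubic_main`):
**`combined_main`**. Everything here is proved; no named fact is introduced.

## References

* W. van Dam, G. Seroussi, arXiv:quant-ph/0207131 (2002), §4 Thm. 1 (proof) [VanDamSeroussi2002].
* K. Ireland, M. Rosen, *A Classical Introduction to Modern Number Theory*, Prop. 9.3.3 [IrelandRosen1990].
-/

noncomputable section

namespace Literature.Computability.Cryptography

namespace VanDamSeroussi

namespace CubicBlock

open Finset Complex
open Literature.Computability.Complexity.ModArith (powM)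
open Literature.Computability.QuantumComplexity.QFTQubits
open Literature.NumberTheory.GaussSums

/-! ### The coset flag selects the character class -/

/-- `powM` read in `ZMod p`. [folklore] -/
theorem natCast_powM {p : ℕ} (hp : 2 ≤ p) (a e : ℕ) : ((powM p a e : ℕ) : ZMod p) = (a : ZMod p) ^ e := by
  rw [powM, if_pos hp, ZMod.natCast_mod, Nat.cast_pow]

/-- `powM` values are reduced. [folklore] -/
theorem powM_lt {p : ℕ} (hp : 2 ≤ p) (a e : ℕ) : powM p a e < p := by
  rw [powM, if_pos hp]; exact Nat.mod_lt _ (by omega)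

/-- Equality of `powM` values is equality in `ZMod p`. [folklore] -/
theorem powM_eq_powM_iff {p : ℕ} (hp : 2 ≤ p) (a e b f : ℕ) :
    powM p a e = powM p b f ↔ (a : ZMod p) ^ e = (b : ZMod p) ^ f := by
  rw [← natCast_powM hp, ← natCast_powM hp]
  constructor
  · intro h; rw [h]
  · intro h
    have := (ZMod.natCast_eq_natCast_iff' (powM p a e) (powM p b f) p).1 h
    rwa [Nat.mod_eq_of_lt (powM_lt hp a e), Nat.mod_eq_of_lt (powM_lt hp b f)] at this

/-- Powers of a primitive cube root agree iff the exponents agree mod `3`. [folklore] -/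
theorem pow_eq_pow_iff_mod_three {M : Type*} [CommMonoid M] {ζ : M} (h : IsPrimitiveRoot ζ 3) (i c : ℕ) :
    ζ ^ i = ζ ^ c ↔ i % 3 = c % 3 := by
  have red : ∀ m, ζ ^ m = ζ ^ (m % 3) := fun m => by
    conv_lhs => rw [← Nat.div_add_mod m 3, pow_add, pow_mul, h.pow_eq_one, one_pow, one_mul]
  rw [red i, red c]
  exact ⟨fun hh => h.pow_inj (Nat.mod_lt _ (by norm_num)) (Nat.mod_lt _ (by norm_num)) hh, fun hh => by rw [hh]⟩

/-- **The character class by the power test.** For a prime `p ≡ 1 (mod 3)`, a primitive root `r`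
and `a ≢ 0`: `χ_{p,r}(a) = ω^c` iff `a^{(p−1)/3} = u^c`, `u = r^{(p−1)/3}`.
[cite: IrelandRosen1990, Prop. 9.3.3] -/
theorem chiN_eq_omega_pow_iff {p r : ℕ} (hp : p.Prime) (h3 : p % 3 = 1) (hr : IsPrimitiveRoot (r : ZMod p) (p - 1))
    {a : ℕ} (ha : (a : ZMod p) ≠ 0) (c : ℕ) :
    chiN p r a = omega ^ c ↔ (a : ZMod p) ^ ((p - 1) / 3) = ((r : ZMod p) ^ ((p - 1) / 3)) ^ c := by
  haveI := Fact.mk hp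
  have hp1 : p - 1 ≠ 0 := Nat.sub_ne_zero_of_lt hp.one_lt
  haveI : NeZero (p - 1) := ⟨hp1⟩
  have h31 : 3 ∣ p - 1 := by have := hp.one_lt; omega
  have hu : IsPrimitiveRoot ((r : ZMod p) ^ ((p - 1) / 3)) 3 := hr.pow (Nat.pos_of_ne_zero hp1) (Nat.div_mul_cancel h31).symm
  obtain ⟨i, -, hi⟩ := hr.eq_pow_of_pow_eq_one (ZMod.pow_card_sub_one_eq_one ha)
  rw [chiN, ← cubicMulChar_apply h3 hr, ← hi, cubicMulChar_apply_pow, ← pow_mul, Nat.mul_comm i, pow_mul]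
  rw [pow_eq_pow_iff_mod_three omega_isPrimitiveRoot, pow_eq_pow_iff_mod_three hu]

/-- **The coset flag selects the character class**: for `x < p`, `x ∈ goodS (p, r, c', ·)` iff
`χ_{p,r}(x) = ω^{c'}`. [cite: VanDamSeroussi2002, §4 Thm. 1 (proof, step 1)] -/
theorem mem_goodS_iff_chiN (Λ : Layout) {d : Layout.Data} (hp : d.p.Prime) (h3 : d.p % 3 = 1)
    (hr : IsPrimitiveRoot (d.r : ZMod d.p) (d.p - 1)) (hpn : d.p < 2 ^ Λ.n) {x : ℕ} (hx : x < d.p) :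
    x ∈ Λ.goodS d ↔ chiN d.p d.r x = omega ^ d.cp := by
  have hp2 := hp.two_le
  rw [Layout.goodS, Finset.mem_filter, Finset.mem_range, flagVal]
  simp only [decide_true, Bool.true_and, Bool.not_eq_false', Bool.and_eq_true, decide_eq_true_eq]
  by_cases hx0 : x = 0
  · subst hx0
    simp only [Nat.le_zero, one_ne_zero, false_and, and_false, false_iff]
    rw [chiN, Nat.cast_zero, cubicChar, if_pos rfl]
    intro h
    rcases Nat.eq_zero_or_pos d.cp with h0 | h0
    · rw [h0, pow_zero] at h; exact zero_ne_one h
    · exact pow_ne_zero _ omega_ne_zero h.symm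
  · have hxz : (x : ZMod d.p) ≠ 0 := by
      rw [Ne, ZMod.natCast_eq_zero_iff]
      exact fun h => hx0 (Nat.eq_zero_of_dvd_of_lt h hx)
    rw [chiN_eq_omega_pow_iff hp h3 hr hxz, powM_eq_powM_iff hp2, natCast_powM hp2]
    constructor
    · rintro ⟨-, -, h⟩; exact h
    · intro h; exact ⟨by omega, ⟨by omega, hx⟩, h⟩

/-! ### Combining the nine statistics -/

namespace Layout

variable (Λ : Layout)

/-- The component `(p, r, c', τ)`. [folklore] -/
def _root_.Literature.Computability.Cryptography.VanDamSeroussi.CubicBlock.dd (p r c' : ℕ) (im : Bool) : Data := ⟨p, r, c', im⟩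

/-- The class property "`χ(k_f) = ω^c`" of a frequency. [folklore] -/
def Pc (p r c : ℕ) (f : ℕ) : Prop := chiN p r (nearIdx Λ.Nmod p f) = omega ^ c

open scoped Classical in
/-- **The statistic** of component `(c', τ)` for class `c`: `P(control = 0, class c) − P(control = 1, class c)`. [cite: VanDamSeroussi2002, §4 Thm. 1 (proof)] -/
def stat (p r c c' : ℕ) (im : Bool) : ℝ :=
  Λ.Pb (dd p r c' im) false (fun γ => Λ.Pc p r c (Λ.freqOf γ)) - Λ.Pb (dd p r c' im) true (fun γ => Λ.Pc p r c (Λ.freqOf γ))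

open scoped Classical in
/-- The exact class sum `T_{c,c'} = Σ_{f : χ(k_f) = ω^c} conj(S f) · R_{c'} f`. [folklore] -/
def Tsum (p r c c' : ℕ) : ℂ :=
  ∑ f ∈ range Λ.Nmod, (if Λ.Pc p r c f then (1 : ℂ) else 0) *
    ((starRingEnd ℂ) (dirichletSum Λ.Nmod (2 ^ Λ.lam) p f) * repFourier Λ.Nmod (2 ^ Λ.lam) p (Λ.indGood (dd p r c' false)) f)

/-- `‖a + b i‖ ≤ |a| + |b|`. [folklore] -/
theorem norm_ofReal_add_mul_I_le (a b : ℝ) : ‖(a : ℂ) + Complex.I * b‖ ≤ |a| + |b| := by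
  refine (norm_add_le _ _).trans ?_
  rw [Complex.norm_real, norm_mul, Complex.norm_I, one_mul, Complex.norm_real, Real.norm_eq_abs, Real.norm_eq_abs]

/-- **The two coins `τ` give real and imaginary parts.** For estimates `e_ff, e_tt` of the statistics
of the components `(c', ff)` and `(c', tt)`: `‖(e_ff + i e_tt) − σ₀ T_{c,c'}‖ ≤ 2 (128κ/B + η)`.
[cite: VanDamSeroussi2002, §3.1 Fact 2] -/
theorem norm_est_sub_Tsum_le {p r : ℕ} (hp : p.Prime) (hpn : p < 2 ^ Λ.n) (hrn : r < 2 ^ Λ.n) (hB : 0 < Λ.B)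
    {c c' : ℕ} (hc' : c' < 3) {η : ℝ} {eff ett : ℝ}
    (hff : |eff - Λ.stat p r c c' false| ≤ η) (htt : |ett - Λ.stat p r c c' true| ≤ η) :
    ‖((eff : ℂ) + Complex.I * ett) - Λ.sigConst * Λ.Tsum p r c c'‖ ≤ 2 * (128 * Λ.kap / Λ.B + η) := by
  classical
  have hNv : Λ.Nmod = 2 ^ Λ.lam * 2 ^ Λ.n * 8 := by unfold Nmod kap; rw [pow_add, pow_add]; norm_num
  have hLN : 2 ^ Λ.lam * p ≤ Λ.Nmod := by
    rw [hNv]; exact (Nat.mul_le_mul_left _ hpn.le).trans (Nat.le_mul_of_pos_right _ (by norm_num))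
  have hok : ∀ im, Λ.DataOK (dd p r c' im) := fun im => ⟨hpn, hrn, by show c' < 4; omega⟩
  have hgood : ∀ im, ∀ s ∈ Λ.goodS (dd p r c' im), s < (dd p r c' im).p := fun im s hs =>
    lt_of_flagVal_false (Finset.mem_filter.1 hs).2
  have h0 := Λ.abs_signal_sub_le (hok false) hp.pos (hgood false) hB hLN (Λ.Pc p r c)
  have h1 := Λ.abs_signal_sub_le (hok true) hp.pos (hgood true) hB hLN (Λ.Pc p r c)
  change |Λ.stat p r c c' false - Λ.sigConst * (1 * Λ.Tsum p r c c').re| ≤ _ at h0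
  change |Λ.stat p r c c' true - Λ.sigConst * (-Complex.I * Λ.Tsum p r c c').re| ≤ _ at h1
  rw [one_mul] at h0
  rw [show (-Complex.I * Λ.Tsum p r c c').re = (Λ.Tsum p r c c').im by simp] at h1
  have hdecomp : ((eff : ℂ) + Complex.I * ett) - Λ.sigConst * Λ.Tsum p r c c' =
      ((eff - Λ.sigConst * (Λ.Tsum p r c c').re : ℝ) : ℂ) + Complex.I * ((ett - Λ.sigConst * (Λ.Tsum p r c c').im : ℝ) : ℂ) := by
    apply Complex.ext <;> simp
  rw [hdecomp]
  refine (norm_ofReal_add_mul_I_le _ _).trans ?_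
  have e0 : |eff - Λ.sigConst * (Λ.Tsum p r c c').re| ≤ 128 * Λ.kap / Λ.B + η := by
    calc |eff - Λ.sigConst * (Λ.Tsum p r c c').re|
        = |(eff - Λ.stat p r c c' false) + (Λ.stat p r c c' false - Λ.sigConst * (Λ.Tsum p r c c').re)| := by ring_nf
      _ ≤ |eff - Λ.stat p r c c' false| + |Λ.stat p r c c' false - Λ.sigConst * (Λ.Tsum p r c c').re| := abs_add_le _ _
      _ ≤ η + 128 * Λ.kap / Λ.B := add_le_add hff h0
      _ = _ := add_comm _ _
  have e1 : |ett - Λ.sigConst * (Λ.Tsum p r c c').im| ≤ 128 * Λ.kap / Λ.B + η := by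
    calc |ett - Λ.sigConst * (Λ.Tsum p r c c').im|
        = |(ett - Λ.stat p r c c' true) + (Λ.stat p r c c' true - Λ.sigConst * (Λ.Tsum p r c c').im)| := by ring_nf
      _ ≤ |ett - Λ.stat p r c c' true| + |Λ.stat p r c c' true - Λ.sigConst * (Λ.Tsum p r c c').im| := abs_add_le _ _
      _ ≤ η + 128 * Λ.kap / Λ.B := add_le_add htt h1
      _ = _ := add_comm _ _
  linarith

/-- **The weighted sum of the class sums is the character-weighted inner product**
`Σ_{c,c'} ω^{c+c'} T_{c,c'} = Σ_f conj(S f) χ(k_f) (Sχ̂)(f)`. [cite: VanDamSeroussi2002, §4 Thm. 1 (proof)] -/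
theorem sum_omega_pow_Tsum {p r : ℕ} (hp : p.Prime) (h3 : p % 3 = 1) (hr : IsPrimitiveRoot (r : ZMod p) (p - 1))
    (hpn : p < 2 ^ Λ.n) :
    ∑ c ∈ range 3, ∑ c' ∈ range 3, omega ^ (c + c') * Λ.Tsum p r c c' =
      ∑ f ∈ range Λ.Nmod, (starRingEnd ℂ) (dirichletSum Λ.Nmod (2 ^ Λ.lam) p f) * chiN p r (nearIdx Λ.Nmod p f) *
        repFourier Λ.Nmod (2 ^ Λ.lam) p (chiN p r) f := by
  classical
  rw [← sum_omega_pow_coset_eq]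
  refine sum_congr rfl fun c _ => sum_congr rfl fun c' _ => ?_
  congr 1
  rw [Tsum, Finset.sum_filter]
  refine sum_congr rfl fun f _ => ?_
  unfold Pc
  split_ifs with h
  · rw [one_mul]; congr 1
    unfold repFourier
    refine sum_congr rfl fun x hx => sum_congr rfl fun j _ => ?_
    congr 1
    rw [Layout.indGood]
    have := mem_goodS_iff_chiN Λ (d := dd p r c' false) hp h3 hr hpn (mem_range.1 hx)
    simp only [dd] at this ⊢
    split_ifs with h1 h2 h2 <;> first | rfl | exact absurd (this.1 h1) h2 | exact absurd (this.2 h2) h1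
  · rw [zero_mul]

/-- **The combined statistic approximates `σ₀ · G · goodWeight`.** For any estimates `e` of the
eighteen statistics within `η`:
`‖Σ_{c,c'} ω^{c+c'}(e_ff + i e_tt) − σ₀ G w‖ ≤ 18 (128κ/B + η) + σ₀ π N √(2^λ) p`.
[cite: VanDamSeroussi2002, §4 Thm. 1 (proof)] -/
theorem combined_main {p r : ℕ} (hp : p.Prime) (h3 : p % 3 = 1) (hr : IsPrimitiveRoot (r : ZMod p) (p - 1))
    (hpn : p < 2 ^ Λ.n) (hrn : r < 2 ^ Λ.n) (hB : 0 < Λ.B) (e : ℕ → ℕ → Bool → ℝ) {η : ℝ}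
    (he : ∀ c, c < 3 → ∀ c', c' < 3 → ∀ im, |e c c' im - Λ.stat p r c c' im| ≤ η) :
    ‖(∑ c ∈ range 3, ∑ c' ∈ range 3, omega ^ (c + c') * ((e c c' false : ℂ) + Complex.I * e c c' true)) -
        Λ.sigConst * (cubicGaussSum p r * goodWeight Λ.Nmod (2 ^ Λ.lam) p)‖ ≤
      18 * (128 * Λ.kap / Λ.B + η) + Λ.sigConst * (Real.pi * Λ.Nmod * Real.sqrt (2 ^ Λ.lam) * p) := by
  have hσ : 0 ≤ Λ.sigConst := by rw [Λ.sigConst_eq]; positivity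
  have hNv : Λ.Nmod = 2 ^ Λ.lam * 2 ^ Λ.n * 8 := by unfold Nmod kap; rw [pow_add, pow_add]; norm_num
  have h8 : 8 * p * 2 ^ Λ.lam ≤ Λ.Nmod := by
    rw [hNv, show 8 * p * 2 ^ Λ.lam = 2 ^ Λ.lam * p * 8 by ring]; gcongr
  obtain ⟨hmain, -, -⟩ := cubic_main (N := Λ.Nmod) (L := 2 ^ Λ.lam) hp h3 hr (by positivity) h8
  rw [← Λ.sum_omega_pow_Tsum hp h3 hr hpn] at hmain
  push_cast at hmain
  -- split off the exact part
  have hsplit : (∑ c ∈ range 3, ∑ c' ∈ range 3, omega ^ (c + c') * ((e c c' false : ℂ) + Complex.I * e c c' true)) -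
      Λ.sigConst * (cubicGaussSum p r * goodWeight Λ.Nmod (2 ^ Λ.lam) p) =
      (∑ c ∈ range 3, ∑ c' ∈ range 3, omega ^ (c + c') * (((e c c' false : ℂ) + Complex.I * e c c' true) - Λ.sigConst * Λ.Tsum p r c c')) +
        (Λ.sigConst : ℂ) * ((∑ c ∈ range 3, ∑ c' ∈ range 3, omega ^ (c + c') * Λ.Tsum p r c c') -
          cubicGaussSum p r * goodWeight Λ.Nmod (2 ^ Λ.lam) p) := by
    simp only [mul_sub, Finset.sum_sub_distrib, Finset.mul_sum]
    have : ∀ c c', (Λ.sigConst : ℂ) * (omega ^ (c + c') * Λ.Tsum p r c c') = omega ^ (c + c') * ((Λ.sigConst : ℂ) * Λ.Tsum p r c c') :=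
      fun c c' => by ring
    simp only [this]
    ring
  rw [hsplit]
  refine (norm_add_le _ _).trans (add_le_add ?_ ?_)
  · refine (norm_sum_le _ _).trans ?_
    calc ∑ c ∈ range 3, ‖∑ c' ∈ range 3, omega ^ (c + c') * (((e c c' false : ℂ) + Complex.I * e c c' true) - Λ.sigConst * Λ.Tsum p r c c')‖
        ≤ ∑ c ∈ range 3, ∑ c' ∈ range 3, 2 * (128 * Λ.kap / Λ.B + η) := by
          refine sum_le_sum fun c hc => (norm_sum_le _ _).trans (sum_le_sum fun c' hc' => ?_)
          rw [norm_mul, norm_pow, norm_omega, one_pow, one_mul]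
          exact Λ.norm_est_sub_Tsum_le hp hpn hrn hB (mem_range.1 hc') (he c (mem_range.1 hc) c' (mem_range.1 hc') false)
            (he c (mem_range.1 hc) c' (mem_range.1 hc') true)
      _ = 18 * (128 * Λ.kap / Λ.B + η) := by simp; ring
  · rw [norm_mul, Complex.norm_real, Real.norm_eq_abs, abs_of_nonneg hσ]
    exact mul_le_mul_of_nonneg_left hmain hσ

/-- **The signal amplitude is bounded below**: `σ₀ · |G| · goodWeight ≥ 1/(2√2)` when `2ⁿ ≤ 2p`
(`n` the bit size of `p`): `|G| = √p`, `goodWeight ≥ 2^λ N/2`, `σ₀ = (1/√2)ⁿ/(2^λ N)`.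
[cite: VanDamSeroussi2002, §4 Thm. 1 (proof)] -/
theorem sigConst_mul_norm_ge {p r : ℕ} (hp : p.Prime) (h3 : p % 3 = 1) (hr : IsPrimitiveRoot (r : ZMod p) (p - 1))
    (hpn : p < 2 ^ Λ.n) (hnp : 2 ^ Λ.n ≤ 2 * p) :
    1 / (2 * Real.sqrt 2) ≤ Λ.sigConst * ‖cubicGaussSum p r * goodWeight Λ.Nmod (2 ^ Λ.lam) p‖ := by
  haveI := Fact.mk hp
  have hNv : Λ.Nmod = 2 ^ Λ.lam * 2 ^ Λ.n * 8 := by unfold Nmod kap; rw [pow_add, pow_add]; norm_num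
  have h8 : 8 * p * 2 ^ Λ.lam ≤ Λ.Nmod := by
    rw [hNv, show 8 * p * 2 ^ Λ.lam = 2 ^ Λ.lam * p * 8 by ring]; gcongr
  obtain ⟨-, hlow, -⟩ := cubic_main (N := Λ.Nmod) (L := 2 ^ Λ.lam) hp h3 hr (by positivity) h8
  have hgw0 : 0 ≤ goodWeight Λ.Nmod (2 ^ Λ.lam) p := by unfold goodWeight; positivity
  rw [norm_mul, norm_cubicGaussSum h3 hr, Complex.norm_real, Real.norm_eq_abs, abs_of_nonneg hgw0, Λ.sigConst_eq]
  have hN : (0 : ℝ) < Λ.Nmod := by unfold Nmod; positivity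
  have hL : (0 : ℝ) < 2 ^ Λ.lam := by positivity
  -- `(1/√2)^n √p ≥ 1/√2`
  have hkey : 1 / Real.sqrt 2 ≤ (1 / Real.sqrt 2) ^ Λ.n * Real.sqrt p := by
    have h2n : (0 : ℝ) < 2 ^ Λ.n := by positivity
    have hsq : ((1 / Real.sqrt 2) ^ Λ.n) = 1 / Real.sqrt (2 ^ Λ.n) := by
      rw [div_pow, one_pow, show Real.sqrt (2 ^ Λ.n) = Real.sqrt 2 ^ Λ.n by
        rw [show (2 : ℝ) ^ Λ.n = (Real.sqrt 2 ^ Λ.n) ^ 2 by rw [← pow_mul, mul_comm, pow_mul, Real.sq_sqrt (by norm_num)],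
          Real.sqrt_sq (by positivity)]]
    rw [hsq, div_mul_eq_mul_div, one_mul, div_le_div_iff₀ (by positivity) (by positivity), one_mul, ← Real.sqrt_mul (by norm_num)]
    exact Real.sqrt_le_sqrt (by rw [mul_comm]; exact_mod_cast hnp)
  calc 1 / (2 * Real.sqrt 2) = (1 / Real.sqrt 2) * (1 / 2) := by ring
    _ ≤ ((1 / Real.sqrt 2) ^ Λ.n * Real.sqrt p) * (goodWeight Λ.Nmod (2 ^ Λ.lam) p / (2 ^ Λ.lam * Λ.Nmod)) := by
        refine mul_le_mul hkey ?_ (by norm_num) (by positivity)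
        push_cast at hlow
        rw [le_div_iff₀ (by positivity)]; linarith
    _ = (1 / Real.sqrt 2) ^ Λ.n / (2 ^ Λ.lam * Λ.Nmod) * (Real.sqrt p * goodWeight Λ.Nmod (2 ^ Λ.lam) p) := by ring

end Layout

end CubicBlock

end VanDamSeroussi

end Literature.Computability.Cryptography
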